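import Summits.RiemannHypothesis.RiemannHypothesis.Theorems.JensenLogBandBandOfShell
import Summits.RiemannHypothesis.RiemannHypothesis.Theorems.JensenLogBandWideBandOfBeyond
import Summits.RiemannHypothesis.RiemannHypothesis.Theorems.JensenLogBandArith
import HarnessLib

/-!
# Route JensenLogBand is ONE crux: `XiDerivBandRealAllRates → XiDerivEdgeReal`, and the leaf from
the BAND — or from the TOP SHELLS — alone (RH-FREE)

Cell rh-jensen, LADDER-RH rung J-P(P3) «log band»; bears_on: J-P(P3); seat rh-jensen-idea-2 g7
(negation-construct lens, round 7). Route-vocabulary corollaries of the two route-independent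
reductions `…Theorems.JensenLogBandRealnessLadder` (EDGE ⇐ BAND at one rate) and
`…Theorems.JensenLogBandBandOfShell` (BAND ⇐ TOP SHELL). RH-FREE. WHAT THIS IS NOT: nothing here
bears on the zeros of `ζ` or the truth of RH; no realness is proved here; a hyperbolicity range with
`N(d) → ∞` is inside Farmer's class by design.

* `xiDerivEdgeReal_of_xiDerivBandRealAllRates : XiDerivBandRealAllRates → XiDerivEdgeReal` — the
  route's rank-3 crux implies its rank-2 crux (BAND instantiated at the single rate `c = 1`);
* `jensenLogBandEighth_of_xiDerivBandRealAllRates : XiDerivBandRealAllRates → JensenLogBandEighth` —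
  the deciding theorem `closes` (binders `hB hW hA` since route rev 3) with the two supports
  discharged by their tree proofs `wideBandOfBeyond_holds`, `logBandArith_holds`;
* `band_and_edge_of_shellAllRates`, `jensenLogBandEighth_of_shellAllRates` — realness of the zeros of
  `ξ₁⁽ᵏ⁾` in the top shells `e^{c(k−1)}/4 ≤ ‖z‖ < e^{ck}` for every rate `c < 8` (all large `k`)
  already gives both cruxes and the leaf.
-/

set_option linter.dupNamespace false

noncomputable section

open Complex Filter Metric Set Topology

namespace Summit.RiemannHypothesis.RiemannHypothesis.Theorems.JensenPolynomials.LogBand.OneCrux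

open Literature.NumberTheory.LFunctions
  Summit.RiemannHypothesis.RiemannHypothesis.Theorems.JensenPolynomials
  Summit.RiemannHypothesis.RiemannHypothesis.Theorems.JensenPolynomials.LogBand
  Summit.RiemannHypothesis.RiemannHypothesis.Theorems.JensenPolynomials.LogBand.RealnessLadder
  Summit.RiemannHypothesis.RiemannHypothesis.Theorems.JensenPolynomials.LogBand.BandOfShell
  Summit.RiemannHypothesis.RiemannHypothesis.Theses.JensenLogBand

/-- **Route vocabulary: `XiDerivBandRealAllRates → XiDerivEdgeReal`** (the route's rank-3 crux implies
its rank-2 crux; instantiate the BAND at the single rate `c = 1` in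
`RealnessLadder.edgeReal_of_bandReal`). RH-FREE. -/
theorem xiDerivEdgeReal_of_xiDerivBandRealAllRates (hB : XiDerivBandRealAllRates) :
    XiDerivEdgeReal := by
  obtain ⟨k₁, hk₁⟩ := hB 1 one_pos (by norm_num)
  exact edgeReal_of_bandReal one_pos hk₁

/-- **The rung leaf from the BAND alone (RH-FREE):** `XiDerivBandRealAllRates → JensenLogBandEighth`,
by the route's deciding theorem `closes` (route rev ≥ 3: binders `hB hW hA`, the EDGE being derived
inside `closes` via `RealnessLadder.edgeReal_of_bandReal`) with the two supports discharged by their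
tree proofs `wideBandOfBeyond_holds`, `logBandArith_holds`. WHAT THIS IS NOT: no claim about the BAND
itself; a hyperbolicity range with `N(d) → ∞` is inside Farmer's class and says nothing about RH. -/
theorem jensenLogBandEighth_of_xiDerivBandRealAllRates (hB : XiDerivBandRealAllRates) :
    JensenLogBandEighth :=
  closes hB wideBandOfBeyond_holds logBandArith_holds

/-- **SHELL at every rate `c < 8` ⇒ both cruxes of the route (RH-FREE).**
`(∀ c ∈ (0,8), ∃ k₁, SHELL(c, k₁)) → XiDerivBandRealAllRates ∧ XiDerivEdgeReal`. For the BAND at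
rate `c' < 8` use the shell at rate `(c'+8)/2`; the EDGE then follows by
`xiDerivEdgeReal_of_xiDerivBandRealAllRates`. -/
theorem band_and_edge_of_shellAllRates
    (hS : ∀ c : ℝ, 0 < c → c < 8 → ∃ k₁ : ℕ, ∀ k : ℕ, k₁ ≤ k → ∀ z : ℂ,
      iteratedDeriv k xiSq z = 0 → Real.exp (c * ((k : ℝ) - 1)) / 4 ≤ ‖z‖ →
      ‖z‖ < Real.exp (c * (k : ℝ)) → z.im = 0) :
    XiDerivBandRealAllRates ∧ XiDerivEdgeReal := by
  have hB : XiDerivBandRealAllRates := by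
    intro c' hc' hc'8
    obtain ⟨k₁, hk₁⟩ := hS ((c' + 8) / 2) (by linarith) (by linarith)
    obtain ⟨n₁, hn₁⟩ := bandReal_of_shellReal hc' (by linarith : c' < (c' + 8) / 2) hk₁
    refine ⟨n₁, fun n hn z hz hlo hhi => hn₁ n hn z hz ?_ hhi⟩
    have h0 : 0 ≤ ((n : ℝ) / Real.log n) ^ 2 := sq_nonneg _
    have : chainRadius n = ((n : ℝ) / Real.log n) ^ 2 / 64 := rfl
    linarith
  exact ⟨hB, xiDerivEdgeReal_of_xiDerivBandRealAllRates hB⟩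

/-- **The rung leaf from the top shells alone (RH-FREE):** SHELL at every rate `c < 8` ⇒
`JensenLogBandEighth`. WHAT THIS IS NOT: no realness is proved here; a hyperbolicity range with
`N(d) → ∞` is inside Farmer's class and says nothing about RH. -/
theorem jensenLogBandEighth_of_shellAllRates
    (hS : ∀ c : ℝ, 0 < c → c < 8 → ∃ k₁ : ℕ, ∀ k : ℕ, k₁ ≤ k → ∀ z : ℂ,
      iteratedDeriv k xiSq z = 0 → Real.exp (c * ((k : ℝ) - 1)) / 4 ≤ ‖z‖ →
      ‖z‖ < Real.exp (c * (k : ℝ)) → z.im = 0) :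
    JensenLogBandEighth :=
  jensenLogBandEighth_of_xiDerivBandRealAllRates (band_and_edge_of_shellAllRates hS).1

end Summit.RiemannHypothesis.RiemannHypothesis.Theorems.JensenPolynomials.LogBand.OneCrux

end
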